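import Summits.AtomisticToContinuum.FouriersLaw.Theorems.BondHeatUncertaintyExtensiveSnapshotIrreversibilityCorrectorIntegrability
import Summits.AtomisticToContinuum.FouriersLaw.Theorems.ExtensiveSnapshotIrreversibility.Negative.DegenerateInstances
import HarnessLib

/-!
# Crux `ExtensiveSnapshotIrreversibility` (stmt-AtomisticToContinuum-9121), line `clausius-budget-sound-window`:
the late-odd-response stub S4 from EXTENSIVE FISHER INFORMATION (registered sub-goal `lateOddResponse_of_extensiveFisher`)

The hardest stub of the line, S4 `stub_lateOddResponse` (the crux's `N`-uniform content: for some `τ ≤ cN` the reversal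
asymmetry `D(P_τ w) = ∫ (P_τ w − (P_τ w)∘Θ)² dμ_T` of the evolved McLennan corrector is `≤ C·N`), follows from the
sibling cards' transfer target "extensive Fisher information of the NESS family at `δ = 0`":
`‖w‖²_{L²(μ_T)} ≤ C'·N` (`w = ∫₀^∞ P_s g ds` the McLennan corrector, `‖w‖² = ‖h‖² = I_δ`; cards
two-bath-fisher-covariance / echo-time-lag-spectral, Disproof §8 "SUFFICIENT: A_N = O(N)"), with `τ = 0`, `c = 1`,
`C = 4 max C' 0`: `P_0 = id` (`pinnedChain_transitionKernel_zero`), and `D(w) ≤ 2‖w‖² + 2‖w∘Θ‖² = 4‖w‖²` by the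
flip-invariance of the Gibbs measure (`Negative.gibbsMeasure_map_flip`); `w ∈ L²(μ_T)` is the landed S2a
`stub_correctorIntegrability`. Harmonic calibration (drefute numerics j013185): `‖w‖² ≤ 0.249 N` over
`ω₂, γ ∈ {0.1, 1, 10}`, `N ≤ 128`. This records in Lean that S4 (hence (K)) is implied by extensive Fisher information;
it does NOT prove either.
-/

noncomputable section

namespace Summit.AtomisticToContinuum.FouriersLaw.Theorems.ExtensiveSnapshotIrreversibility.ClausiusBudget

open MeasureTheory Filter Topology
open scoped ENNReal NNReal
open Literature.MathematicalPhysics.KineticTheory.HeatConduction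

/-- Elementary: `∫ (a − b)² ≤ 2∫a² + 2∫b²` for `a, b ∈ L²(μ)`. [folklore] -/
theorem integral_sub_sq_le_two_mul {X : Type*} [MeasurableSpace X] {μ : Measure X} {a b : X → ℝ}
    (ha : MemLp a 2 μ) (hb : MemLp b 2 μ) :
    ∫ x, (a x - b x) ^ 2 ∂μ ≤ 2 * ∫ x, (a x) ^ 2 ∂μ + 2 * ∫ x, (b x) ^ 2 ∂μ := by
  have ha2 : Integrable (fun x => (a x) ^ 2) μ := ha.integrable_sq
  have hb2 : Integrable (fun x => (b x) ^ 2) μ := hb.integrable_sq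
  have hab2 : Integrable (fun x => (a x + b x) ^ 2) μ := (ha.add hb).integrable_sq
  have hpt : ∀ x, (a x - b x) ^ 2 ≤ 2 * (a x) ^ 2 + 2 * (b x) ^ 2 := fun x => by
    nlinarith [sq_nonneg (a x + b x)]
  calc ∫ x, (a x - b x) ^ 2 ∂μ ≤ ∫ x, (2 * (a x) ^ 2 + 2 * (b x) ^ 2) ∂μ := by
        refine integral_mono_of_nonneg (ae_of_all _ fun x => sq_nonneg _)
          ((ha2.const_mul 2).add (hb2.const_mul 2)) (ae_of_all _ hpt)
    _ = 2 * ∫ x, (a x) ^ 2 ∂μ + 2 * ∫ x, (b x) ^ 2 ∂μ := by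
        rw [integral_add (ha2.const_mul 2) (hb2.const_mul 2), integral_const_mul, integral_const_mul]

/-- **S4 from extensive Fisher information** (registered sub-goal; see the module docstring): if the McLennan corrector
has `‖w‖²_{L²(μ_T)} ≤ C'·N` for all `N ≥ 2`, then the late-odd-response statement S4 holds with `c = 1`, `τ = 0`,
`C = 4 max C' 0`. [folklore] -/
theorem lateOddResponse_of_extensiveFisher :
    ∀ ω₂ lam β γ : ℝ, 0 < ω₂ → 0 < lam → 0 < β → 0 < γ →
      (∀ (N : ℕ) (T_L T_R : ℝ), 0 < T_L → 0 < T_R → ∀ μ ν : Measure (PhaseSpace N),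
        (pinnedChain ω₂ lam β γ).IsSteadyState N T_L T_R μ →
        (pinnedChain ω₂ lam β γ).IsSteadyState N T_L T_R ν → μ = ν) →
      ∀ T : ℝ, 0 < T → (∃ C' : ℝ, ∀ (N : ℕ) (hN : 2 ≤ N),
        let P := pinnedChain ω₂ lam β γ
        let μT := P.gibbsMeasure N T
        let g : PhaseSpace N → ℝ := fun y =>
          γ / (2 * T ^ 2) * (y.2 ⟨0, by omega⟩ ^ 2 - y.2 ⟨N - 1, by omega⟩ ^ 2)
        let Pg : ℝ → PhaseSpace N → ℝ := fun s z => ∫ y, g y ∂(P.transitionKernel N T T s.toNNReal z)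
        let w : PhaseSpace N → ℝ := fun z => ∫ s in Set.Ioi (0 : ℝ), Pg s z
        ∫ z, (w z) ^ 2 ∂μT ≤ C' * N) →
      ∃ C c : ℝ, 0 < c ∧ ∀ (N : ℕ) (hN : 2 ≤ N),
        let P := pinnedChain ω₂ lam β γ
        let μT := P.gibbsMeasure N T
        (∀ t : ℝ≥0, μT.bind (P.transitionKernel N T T t) = μT) →
        (∀ ϑ : ℝ, 0 < ϑ → ϑ < 1 / T → ∃ C c : ℝ, 0 < C ∧ 0 < c ∧
          ∀ (z : PhaseSpace N) (t : ℝ≥0) (f : PhaseSpace N → ℝ), Continuous f →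
            (∀ y, |f y| ≤ Real.exp (ϑ * P.hamiltonian N y)) →
            |(∫ y, f y ∂(P.transitionKernel N T T t z)) - ∫ y, f y ∂μT| ≤
              C * Real.exp (ϑ * P.hamiltonian N z) * Real.exp (-c * t)) →
        let g : PhaseSpace N → ℝ := fun y =>
          γ / (2 * T ^ 2) * (y.2 ⟨0, by omega⟩ ^ 2 - y.2 ⟨N - 1, by omega⟩ ^ 2)
        let Pg : ℝ → PhaseSpace N → ℝ := fun s z => ∫ y, g y ∂(P.transitionKernel N T T s.toNNReal z)
        let w : PhaseSpace N → ℝ := fun z => ∫ s in Set.Ioi (0 : ℝ), Pg s z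
        let Pw : ℝ → PhaseSpace N → ℝ := fun τ z => ∫ x, w x ∂(P.transitionKernel N T T τ.toNNReal z)
        ∃ τ : ℝ, 0 ≤ τ ∧ τ ≤ c * N ∧ MemLp (Pw τ) 2 μT ∧
          ∫ z, (Pw τ z - Pw τ (z.1, -z.2)) ^ 2 ∂μT ≤ C * N := by
  intro ω₂ lam β γ hω hl hβ hγ hU T hT hFisher
  obtain ⟨C', hC'⟩ := hFisher
  refine ⟨4 * max C' 0, 1, one_pos, fun N hN => ?_⟩
  intro P μT hInv hMix g Pg w Pw
  -- `w ∈ L²(μ_T)` from the landed S2a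
  obtain ⟨-, hw2, -⟩ := stub_correctorIntegrability ω₂ lam β γ hω hl hβ hγ T hT N hN hInv hMix
  have hFN : ∫ z, (w z) ^ 2 ∂μT ≤ C' * N := hC' N hN
  -- `P_0 w = w`
  have hP0 : ∀ z, Pw 0 z = w z := by
    intro z
    show ∫ x, w x ∂(P.transitionKernel N T T (Real.toNNReal 0) z) = w z
    rw [Real.toNNReal_zero, pinnedChain_transitionKernel_zero hω hl.le hβ.le hγ.le N T T, ProbabilityTheory.Kernel.id_apply,
      integral_dirac]
  have hPw0 : Pw 0 = w := funext hP0
  refine ⟨0, le_rfl, by positivity, ?_, ?_⟩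
  · rw [hPw0]; exact hw2
  · rw [hPw0]
    -- flip invariance of the Gibbs measure
    have hΘ : MeasurePreserving (momentumReversal N) μT μT :=
      ⟨(momentumReversal N).measurable, Negative.gibbsMeasure_map_flip (pinnedChain ω₂ lam β γ) N T⟩
    have hwΘ : MemLp (fun z => w (z.1, -z.2)) 2 μT := hw2.comp_measurePreserving hΘ
    have hint : ∫ z, (w (z.1, -z.2)) ^ 2 ∂μT = ∫ z, (w z) ^ 2 ∂μT :=
      hΘ.integral_comp' (f := momentumReversal N) (fun z => (w z) ^ 2)
    have hN0 : (0 : ℝ) ≤ N := by positivity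
    calc ∫ z, (w z - w (z.1, -z.2)) ^ 2 ∂μT
        ≤ 2 * ∫ z, (w z) ^ 2 ∂μT + 2 * ∫ z, (w (z.1, -z.2)) ^ 2 ∂μT := integral_sub_sq_le_two_mul hw2 hwΘ
      _ = 4 * ∫ z, (w z) ^ 2 ∂μT := by rw [hint]; ring
      _ ≤ 4 * (C' * N) := by linarith
      _ ≤ 4 * max C' 0 * N := by nlinarith [le_max_left C' 0, hN0]

end Summit.AtomisticToContinuum.FouriersLaw.Theorems.ExtensiveSnapshotIrreversibility.ClausiusBudget

end
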